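import Mathlib
import HarnessLib
import Literature.MathematicalPhysics.QuantumLattice.GaugeGroups
import Literature.MathematicalPhysics.QuantumFieldTheory.ConstructiveQFTWave0
import Literature.MathematicalPhysics.QuantumFieldTheory.UnitaryCayleyChart
import Summits.Ventures.LatticeQCDFlow.Scaling.LatticeEntropyUN
import Summits.Ventures.LatticeQCDFlow.Scaling.U1ExtensiveAction

/-!
# LatticeQCDFlow / Scaling — `U(1)` as `𝔾 1 = U(1) ⊂ M₁(ℂ)`: the extensive-action configuration at
every `L ≥ 2` in row 30's matrix model (v2.5)

HONEST FRAMING: exact (Metropolis-corrected) sampling algorithms for lattice gauge theory; figures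
of merit are autocorrelation/cost numbers at stated couplings and volumes; no continuum-physics
claim.

Venture `LatticeQCDFlow` (cell pub-lqcd), topic `Scaling`, FANOUT row 29 (theory2) — OUR WORK
(THEORY-2.md v2.5 §3.3, row C2a).  Companion of `Scaling/U1ExtensiveAction.lean` (the `Circle`
model): the same twisted configuration in row 30's matrix model
`𝔾 N = Matrix.unitaryGroup (Fin N) ℂ` of `Scaling/ExactTransportUN.lean` at `N = 1`, where the Haar
ball-volume inputs `UN.haar_closedBall_ge/le` of row 30's (C2a) theorem are already available for
every `N` and only the extensive-action configuration was missing (row 30's `UN.exists_action_ge`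
needs `N ≥ 2`; for `N = 1` no such configuration exists at `L = 1`).  With
`phase θ = (e^{iθ}) ∈ 𝔾 1`: `twistM d L hd` puts `phase(θ_L x₁)` on the `e₀`-links; every
`(e₀, e₁)`-plaquette is `phase(±θ_L mod 2π)` with `Re tr = cos θ_L ≤ −1/2` (`cos_twist_step`,
`cos_twistAngle_le`), so
`wilsonAction (unitaryFundamentalRep (Fin 1) ℂ) (twistM d L hd) ≥ (3/2)·L^d` for `d ≥ 2`, `L ≥ 2`
(`wilsonAction_twistM_ge`, `extensive_action_matrix`).  Hence (C2a-R) for `𝔾 1` follows from row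
30's `exactTransportBiLipschitz_of_ballVolumes` once its `hconf` and conclusion are restricted to
`L ≥ 2`.  Elementary; nothing is cited as a fact.
-/

noncomputable section

open MeasureTheory Real Set
open Literature.MathematicalPhysics.QuantumFieldTheory
open Literature.MathematicalPhysics.QuantumFieldTheory.UnitaryCayley (𝔾)
open Literature.MathematicalPhysics.QuantumLattice (unitaryFundamentalRep
  unitaryFundamentalRep_apply)

namespace Summit.Ventures.LatticeQCDFlow.Theory2.Lattice.U1

variable {d : ℕ}

/-- The phase `e^{iθ}` as a `1 × 1` complex matrix. [folklore] -/
def phaseM (θ : ℝ) : Matrix (Fin 1) (Fin 1) ℂ :=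
  Matrix.diagonal fun _ => Complex.exp (θ * Complex.I)

/-- `phaseM a · phaseM b = phaseM (a + b)`. [folklore] -/
theorem phaseM_mul (a b : ℝ) : phaseM a * phaseM b = phaseM (a + b) := by
  rw [phaseM, phaseM, phaseM, Matrix.diagonal_mul_diagonal]
  congr 1
  funext i
  rw [← Complex.exp_add]
  push_cast
  ring_nf

/-- `phaseM 0 = 1`. [folklore] -/
theorem phaseM_zero : phaseM 0 = 1 := by
  rw [phaseM, ← Matrix.diagonal_one]
  congr 1
  funext i
  simp

/-- `(phaseM θ)† = phaseM (−θ)`. [folklore] -/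
theorem star_phaseM (θ : ℝ) : star (phaseM θ) = phaseM (-θ) := by
  rw [Matrix.star_eq_conjTranspose, phaseM, Matrix.diagonal_conjTranspose, phaseM]
  congr 1
  funext i
  rw [Pi.star_apply, Complex.star_def, ← Complex.exp_conj, map_mul, Complex.conj_ofReal,
    Complex.conj_I]
  push_cast
  ring_nf

/-- `phaseM θ` is unitary. [folklore] -/
theorem phaseM_mem (θ : ℝ) : phaseM θ ∈ Matrix.unitaryGroup (Fin 1) ℂ := by
  rw [Matrix.mem_unitaryGroup_iff, star_phaseM, phaseM_mul, add_neg_cancel, phaseM_zero]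

/-- The phase `e^{iθ}` as an element of `U(1) = 𝔾 1`. [folklore] -/
def phase (θ : ℝ) : 𝔾 1 := ⟨phaseM θ, phaseM_mem θ⟩

/-- `phase a · phase b = phase (a + b)`. [folklore] -/
theorem phase_mul (a b : ℝ) : phase a * phase b = phase (a + b) :=
  Subtype.ext (phaseM_mul a b)

/-- `(phase θ)⁻¹ = phase (−θ)`. [folklore] -/
theorem phase_inv (θ : ℝ) : (phase θ)⁻¹ = phase (-θ) := by
  rw [← Unitary.star_eq_inv]
  exact Subtype.ext (by rw [Unitary.coe_star]; exact star_phaseM θ)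

/-- `Re tr (phase θ) = cos θ`. [folklore] -/
theorem re_trace_phase (θ : ℝ) :
    (unitaryFundamentalRep (Fin 1) ℂ (phase θ)).trace.re = Real.cos θ := by
  rw [unitaryFundamentalRep_apply]
  show (phaseM θ).trace.re = Real.cos θ
  rw [phaseM, Matrix.trace_diagonal, Fin.sum_univ_one, Complex.exp_ofReal_mul_I_re]

/-- The twisted configuration in the matrix model: `U(x, e₀) = phase(θ_L x₁)`, other links `1`.
[folklore] -/
def twistM (d L : ℕ) (hd : 2 ≤ d) : GaugeConfig d L (𝔾 1) := fun e =>
  if e.2 = dir0 hd then phase (twistAngle L * ((e.1 (dir1 hd)).val : ℝ)) else 1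

/-- The `(e₀, e₁)`-plaquette holonomy of `twistM`. [folklore] -/
theorem plaquetteHolonomy_twistM {L : ℕ} (hd : 2 ≤ d) (x : Site d L) :
    plaquetteHolonomy (twistM d L hd) x (dir0 hd) (dir1 hd) =
      phase (twistAngle L * ((x (dir1 hd)).val : ℝ) -
        twistAngle L * (((x (dir1 hd)) + 1).val : ℝ)) := by
  have h10 := dir1_ne_dir0 hd
  have hs1 : (x.shift (dir1 hd)) (dir1 hd) = x (dir1 hd) + 1 := by
    simp [Site.shift]
  unfold plaquetteHolonomy
  simp only [twistM, if_neg h10, hs1, mul_one, inv_one, reduceIte, phase_inv, phase_mul,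
    sub_eq_add_neg]

/-- Every `(e₀, e₁)`-plaquette of `twistM` has `Re tr = cos θ_L`. [folklore] -/
theorem re_trace_hol_twistM {L : ℕ} [NeZero L] (hL : 2 ≤ L) (hd : 2 ≤ d) (x : Site d L) :
    (unitaryFundamentalRep (Fin 1) ℂ
        (plaquetteHolonomy (twistM d L hd) x (dir0 hd) (dir1 hd))).trace.re =
      Real.cos (twistAngle L) := by
  rw [plaquetteHolonomy_twistM, re_trace_phase, cos_twist_step hL]

/-- **`S(twistM) ≥ (3/2)·L^d`** in the matrix model, `L ≥ 2`, `d ≥ 2`. [folklore] -/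
theorem wilsonAction_twistM_ge {L : ℕ} [NeZero L] (hd : 2 ≤ d) (hL : 2 ≤ L) :
    (3 / 2 : ℝ) * (L : ℝ) ^ d ≤ wilsonAction (unitaryFundamentalRep (Fin 1) ℂ) (twistM d L hd) := by
  unfold wilsonAction
  rw [Fintype.sum_prod_type]
  set q0 : {p : Fin d × Fin d // p.1 < p.2} := ⟨(dir0 hd, dir1 hd), dir0_lt_dir1 hd⟩ with hq0
  have hnn : ∀ (x : Site d L) (q : {p : Fin d × Fin d // p.1 < p.2}),
      0 ≤ ((1 : ℕ) : ℝ) - (unitaryFundamentalRep (Fin 1) ℂ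
        (plaquetteHolonomy (twistM d L hd) x q.1.1 q.1.2)).trace.re :=
    fun x q => sub_nonneg.2 (UN.re_trace_le _)
  have hcard : (Fintype.card (Site d L) : ℝ) = (L : ℝ) ^ d := by
    rw [Fintype.card_fun, ZMod.card, Fintype.card_fin]
    push_cast
    rfl
  calc (3 / 2 : ℝ) * (L : ℝ) ^ d = ∑ _x : Site d L, (3 / 2 : ℝ) := by
        rw [Finset.sum_const, Finset.card_univ, nsmul_eq_mul, hcard, mul_comm]
    _ ≤ ∑ x : Site d L, (((1 : ℕ) : ℝ) - (unitaryFundamentalRep (Fin 1) ℂ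
          (plaquetteHolonomy (twistM d L hd) x (dir0 hd) (dir1 hd))).trace.re) := by
        refine Finset.sum_le_sum fun x _ => ?_
        rw [re_trace_hol_twistM hL hd x]
        have := cos_twistAngle_le hL
        push_cast
        linarith
    _ ≤ ∑ x : Site d L, ∑ q : {p : Fin d × Fin d // p.1 < p.2}, (((1 : ℕ) : ℝ) -
          (unitaryFundamentalRep (Fin 1) ℂ (plaquetteHolonomy (twistM d L hd) (x, q).1
            (x, q).2.1.1 (x, q).2.1.2)).trace.re) := by
        refine Finset.sum_le_sum fun x _ => ?_
        have h := Finset.single_le_sum (f := fun q : {p : Fin d × Fin d // p.1 < p.2} =>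
          ((1 : ℕ) : ℝ) - (unitaryFundamentalRep (Fin 1) ℂ
            (plaquetteHolonomy (twistM d L hd) x q.1.1 q.1.2)).trace.re)
          (fun q _ => hnn x q) (Finset.mem_univ q0)
        simpa [hq0] using h

/-- **Extensive action for `𝔾 1` at every volume `L ≥ 2`** (`d ≥ 2`): row 30's `hconf` at
`N = 1`, restricted to `L ≥ 2` as (C2a-R) requires. [folklore] -/
theorem extensive_action_matrix (hd : 2 ≤ d) (L : ℕ) [NeZero L] (hL : 2 ≤ L) :
    ∃ V : GaugeConfig d L (𝔾 1),
      (3 / 2 : ℝ) * (L : ℝ) ^ d ≤ wilsonAction (unitaryFundamentalRep (Fin 1) ℂ) V :=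
  ⟨twistM d L hd, wilsonAction_twistM_ge hd hL⟩

end Summit.Ventures.LatticeQCDFlow.Theory2.Lattice.U1

end
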